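import Literature.Probability.Percolation.DecisionTreeTwoConfig
import Mathlib.Tactic.Linarith
import HarnessLib

/-!
# The decision-tree Harris–Kleitman inequality for general two-configuration trees
# (Gladkov 2024, Theorem 3.2, for trees of Def. 2.4 with `S`/`S̄` decisions)

Topic `Literature/Probability/Percolation`; proofs-only companion of `DecisionTreeTwoConfig.lean`.
Source: N. Gladkov, *Percolation Inequalities and Decision Trees*, arXiv:2408.08457v2 (2024)
[Gladkov2024], Theorem 3.2 (p. 4): "Let `G` be finite. Let `S(C₁, C₂)` be built by some decision
tree. Assume `A` and `B` are some events in `Ω` closed upward. Then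
`P(C₁ ∈ A, C₁ →_S C₂ ∈ B) ≥ P(C₁ ∈ A) P(C₁ →_S C₂ ∈ B) = μ(A) μ(B)`."  The tree's
`DecisionTreeWeighted.PrW_mul_PrW_le_Pr2W_treeHK` is this for trees reading `C₁` only with all-`S`
decisions; here it is PROVED for the general class `DTree2` (trees branching on both configurations,
with an `S`/`S̄` decision at every node, no descendant re-querying an ancestor's edge):

* `PrW_split` — `P(X) = Σ_b w_e(b) · P_{D∖e}{R : ins e b R ∈ X}` (one-coordinate disintegration);
* `one_bit_harris` — Harris on one Bernoulli bit: `E[a]E[b] ≤ E[ab]` for `a, b` increasing in the bit;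
* **`PrW_mul_PrW_le_Pr2W_treeHK2`** — Theorem 3.2: `P(A) P(B) ≤ P⊗P{C₁ ∈ A, C₁ →_S C₂ ∈ B}` for
  up-closed `A, B`, `T` valid with `support2 T ⊆ D`, `0 ≤ p ≤ 1`.

Proof (a root-first induction, shorter than the printed lowest-`S`-node surgery but the same
inequality at each node): split the pair space along the root edge `e` (`sum_pairs_split`); on the block
`(C₁ e, C₂ e) = (b₁, b₂)` the event becomes `{R₁ ∈ A_{b₁}, (R₁ →_{S'} R₂) ∈ B_{β₁}}` for the child tree
on `D ∖ e` (`swap2_node_ins`; `A_b = {R : ins e b R ∈ A}` is up-closed and increasing in `b`;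
`β₁ = b₁` for an `S`-decision, `b₂` for an `S̄`-decision), which the induction hypothesis bounds below
by `P'(A_{b₁}) P'(B_{β₁})`; summing, an `S̄`-node gives exactly `P(A) P(B)` and an `S`-node gives
`E[a(b) b(b)] ≥ E[a] E[b] = P(A) P(B)` by Harris on the single bit `b = C₁ e`.
-/

noncomputable section

open Classical

namespace Literature.Probability.Percolation

namespace DecisionTree

namespace DTree2

open Finset

variable {ι : Type*} [DecidableEq ι]

section HK

variable (D : Finset ι) {p : ι → ℝ}

omit [DecidableEq ι] in
/-- The two one-bit weights sum to one. [folklore] -/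
theorem sum_wt1 (p : ι → ℝ) (e : ι) : ∑ b : Bool, wt1 p e b = 1 := by
  rw [Fintype.sum_bool]; simp [wt1]

/-- One-coordinate disintegration of `PrW` along `e ∈ D`:
`P(X) = Σ_b w_e(b) · P_{D ∖ e}{R : ins e b R ∈ X}`. [folklore] -/
theorem PrW_split (p : ι → ℝ) {e : ι} (he : e ∈ D) (X : Set (Finset ι)) :
    PrW D p X = ∑ b : Bool, wt1 p e b * PrW (D.erase e) p {R | ins e b R ∈ X} := by
  rw [PrW_eq_sum_ind, sum_powerset_split D he]
  refine sum_congr rfl fun b _ => ?_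
  rw [PrW_eq_sum_ind, mul_sum]
  refine sum_congr rfl fun R hR => ?_
  rw [mem_powerset] at hR
  rw [wtW_ins D p he b hR, mul_assoc]
  rfl

omit [DecidableEq ι] in
/-- **Harris on one Bernoulli bit**: for `0 ≤ p_e ≤ 1` and `a, b : Bool → ℝ` increasing
(`a false ≤ a true`, `b false ≤ b true`), `(Σ_b w(b) a(b)) (Σ_b w(b) b(b)) ≤ Σ_b w(b) a(b) b(b)`.
[cite: Gladkov2024, Thm 3.2 (the one-edge step, inequality (5))] -/
theorem one_bit_harris (p : ι → ℝ) (e : ι) (hp0 : 0 ≤ p e) (hp1 : p e ≤ 1) {a b : Bool → ℝ}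
    (ha : a false ≤ a true) (hb : b false ≤ b true) :
    (∑ c : Bool, wt1 p e c * a c) * (∑ c : Bool, wt1 p e c * b c) ≤
      ∑ c : Bool, wt1 p e c * (a c * b c) := by
  simp only [Fintype.sum_bool, wt1, if_true, Bool.false_eq_true, if_false]
  have key : (p e * (a true * b true) + (1 - p e) * (a false * b false)) -
      (p e * a true + (1 - p e) * a false) * (p e * b true + (1 - p e) * b false) =
        p e * (1 - p e) * ((a true - a false) * (b true - b false)) := by ring
  have h1 : 0 ≤ 1 - p e := sub_nonneg.2 hp1
  have h2 : 0 ≤ a true - a false := sub_nonneg.2 ha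
  have h3 : 0 ≤ b true - b false := sub_nonneg.2 hb
  have hnn : 0 ≤ p e * (1 - p e) * ((a true - a false) * (b true - b false)) :=
    mul_nonneg (mul_nonneg hp0 h1) (mul_nonneg h2 h3)
  linarith

/-- The section `{R : ins e b R ∈ X}` of an up-closed event is up-closed. [folklore] -/
theorem isUpperSet_section {X : Set (Finset ι)} (hX : IsUpperSet X) (e : ι) (b : Bool) :
    IsUpperSet {R : Finset ι | ins e b R ∈ X} := by
  intro R R' hRR' hR
  refine hX ?_ hR
  show ins e b R ≤ ins e b R'
  cases b
  · exact hRR'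
  · exact insert_subset_insert e hRR'

/-- The sections of an up-closed event increase with the bit: `{ins e false R ∈ X} ⊆ {ins e true R ∈ X}`.
[folklore] -/
theorem section_mono {X : Set (Finset ι)} (hX : IsUpperSet X) (e : ι) {R : Finset ι}
    (h : ins e false R ∈ X) : ins e true R ∈ X :=
  hX (show ins e false R ≤ ins e true R from subset_insert e R) h

/-- **Gladkov's Theorem 3.2 (decision-tree Harris–Kleitman) for general two-configuration trees.**
For a valid tree `T` querying edges of `D`, weights `0 ≤ p ≤ 1`, and up-closed events `A, B`:
`P(A) · P(B) ≤ P⊗P{(C₁, C₂) : C₁ ∈ A, C₁ →_S C₂ ∈ B}`, `S = S(C₁, C₂)` the set built by `T`.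
[cite: Gladkov2024, Thm. 3.2] -/
theorem PrW_mul_PrW_le_Pr2W_treeHK2 (hp0 : ∀ i, 0 ≤ p i) (hp1 : ∀ i, p i ≤ 1) (T : DTree2 ι)
    (hV : Valid2 T) (D : Finset ι) (hD : support2 T ⊆ D) {A B : Set (Finset ι)} (hA : IsUpperSet A)
    (hB : IsUpperSet B) :
    PrW D p A * PrW D p B ≤ Pr2W D p {x | x.1 ∈ A ∧ (swap2 T x).1 ∈ B} := by
  induction T generalizing D A B with
  | leaf =>
      simp only [swap2_leaf]
      rw [← Pr2W_prod]
      exact le_of_eq (congrArg _ (by ext x; simp [Set.mem_prod]))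
  | node e toS c11 c10 c01 c00 ih11 ih10 ih01 ih00 =>
      have he : e ∈ D := hD (by simp [support2])
      -- the right-hand side, split along `e`
      rw [Pr2W_eq_sum_ind, sum_pairs_split D p he]
      -- each block is the child's HK event on `D.erase e`
      have hblock : ∀ b₁ b₂ : Bool,
          PrW (D.erase e) p {R | ins e b₁ R ∈ A} * PrW (D.erase e) p {R | ins e (if toS then b₁ else b₂) R ∈ B} ≤
          ∑ y ∈ (D.erase e).powerset ×ˢ (D.erase e).powerset, wt2W (D.erase e) p y *
            ind {x | x.1 ∈ A ∧ (swap2 (node e toS c11 c10 c01 c00) x).1 ∈ B} (ins e b₁ y.1, ins e b₂ y.2) := by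
        intro b₁ b₂
        obtain ⟨hvc, hec⟩ := valid2_child hV b₁ b₂
        have hDc : support2 (child c11 c10 c01 c00 b₁ b₂) ⊆ D.erase e := by
          intro i hi
          exact mem_erase.2 ⟨fun h => hec (h ▸ hi), hD (support2_child_subset e toS c11 c10 c01 c00 b₁ b₂ hi)⟩
        have ih := forall_child (P := fun T => Valid2 T → ∀ D', support2 T ⊆ D' →
            ∀ A' B' : Set (Finset ι), IsUpperSet A' → IsUpperSet B' →
              PrW D' p A' * PrW D' p B' ≤ Pr2W D' p {x | x.1 ∈ A' ∧ (swap2 T x).1 ∈ B'})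
          (fun hv D' hd A' B' hA' hB' => ih11 hv D' hd hA' hB')
          (fun hv D' hd A' B' hA' hB' => ih10 hv D' hd hA' hB')
          (fun hv D' hd A' B' hA' hB' => ih01 hv D' hd hA' hB')
          (fun hv D' hd A' B' hA' hB' => ih00 hv D' hd hA' hB') b₁ b₂ hvc (D.erase e) hDc
          {R | ins e b₁ R ∈ A} {R | ins e (if toS then b₁ else b₂) R ∈ B}
          (isUpperSet_section hA e b₁) (isUpperSet_section hB e _)
        refine ih.trans (le_of_eq ?_)
        rw [Pr2W_eq_sum_ind]
        refine sum_congr rfl fun y hy => ?_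
        rw [mem_product, mem_powerset, mem_powerset] at hy
        have hR₁ : e ∉ y.1 := fun h => (mem_erase.1 (hy.1 h)).1 rfl
        have hR₂ : e ∉ y.2 := fun h => (mem_erase.1 (hy.2 h)).1 rfl
        congr 1
        have hiff : y ∈ {x : Finset ι × Finset ι | x.1 ∈ {R | ins e b₁ R ∈ A} ∧
              (swap2 (child c11 c10 c01 c00 b₁ b₂) x).1 ∈ {R | ins e (if toS then b₁ else b₂) R ∈ B}} ↔
            (ins e b₁ y.1, ins e b₂ y.2) ∈
              {x : Finset ι × Finset ι | x.1 ∈ A ∧ (swap2 (node e toS c11 c10 c01 c00) x).1 ∈ B} := by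
          simp only [Set.mem_setOf_eq, swap2_node_ins hV b₁ b₂ hR₁ hR₂]
        by_cases h : y ∈ {x : Finset ι × Finset ι | x.1 ∈ {R | ins e b₁ R ∈ A} ∧
              (swap2 (child c11 c10 c01 c00 b₁ b₂) x).1 ∈ {R | ins e (if toS then b₁ else b₂) R ∈ B}}
        · rw [ind_of_mem h, ind_of_mem (hiff.1 h)]
        · rw [ind_of_not_mem h, ind_of_not_mem (fun h' => h (hiff.2 h'))]
      -- assemble: lower bound by the weighted sum of the block products
      set a : Bool → ℝ := fun b => PrW (D.erase e) p {R | ins e b R ∈ A} with ha_def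
      set bb : Bool → ℝ := fun b => PrW (D.erase e) p {R | ins e b R ∈ B} with hb_def
      have hPA : PrW D p A = ∑ b : Bool, wt1 p e b * a b := PrW_split D p he A
      have hPB : PrW D p B = ∑ b : Bool, wt1 p e b * bb b := PrW_split D p he B
      have hw0 : ∀ b : Bool, 0 ≤ wt1 p e b := fun b => by
        cases b <;> simp [wt1, hp0 e, sub_nonneg.2 (hp1 e)]
      have hlow : ∑ b₁ : Bool, ∑ b₂ : Bool, wt1 p e b₁ * wt1 p e b₂ * (a b₁ * bb (if toS then b₁ else b₂)) ≤
          ∑ b₁ : Bool, ∑ b₂ : Bool, wt1 p e b₁ * wt1 p e b₂ *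
            ∑ y ∈ (D.erase e).powerset ×ˢ (D.erase e).powerset, wt2W (D.erase e) p y *
              ind {x | x.1 ∈ A ∧ (swap2 (node e toS c11 c10 c01 c00) x).1 ∈ B} (ins e b₁ y.1, ins e b₂ y.2) :=
        sum_le_sum fun b₁ _ => sum_le_sum fun b₂ _ =>
          mul_le_mul_of_nonneg_left (hblock b₁ b₂) (mul_nonneg (hw0 b₁) (hw0 b₂))
      refine le_trans ?_ hlow
      rw [hPA, hPB]
      cases toS
      · -- `S̄`-decision: the product factorises exactly
        simp only [Bool.false_eq_true, if_false]
        rw [sum_mul_sum]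
        refine le_of_eq (sum_congr rfl fun b₁ _ => sum_congr rfl fun b₂ _ => by ring)
      · -- `S`-decision: Harris on the bit `C₁ e`
        simp only [if_true]
        have hmono_a : a false ≤ a true :=
          PrW_mono (D.erase e) hp0 hp1 fun R _ hR => section_mono hA e hR
        have hmono_b : bb false ≤ bb true :=
          PrW_mono (D.erase e) hp0 hp1 fun R _ hR => section_mono hB e hR
        have hR : ∑ b₁ : Bool, ∑ b₂ : Bool, wt1 p e b₁ * wt1 p e b₂ * (a b₁ * bb b₁) =
            ∑ b₁ : Bool, wt1 p e b₁ * (a b₁ * bb b₁) := by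
          refine sum_congr rfl fun b₁ _ => ?_
          have h1 : ∑ b₂ : Bool, wt1 p e b₁ * wt1 p e b₂ * (a b₁ * bb b₁) =
              (wt1 p e b₁ * (a b₁ * bb b₁)) * ∑ b₂ : Bool, wt1 p e b₂ := by
            rw [mul_sum]
            exact sum_congr rfl fun b₂ _ => by ring
          rw [h1, sum_wt1, mul_one]
        rw [hR]
        exact one_bit_harris p e (hp0 e) (hp1 e) hmono_a hmono_b

end HK

end DTree2

end DecisionTree

end Literature.Probability.Percolation

end
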